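import Summits.KontsevichZagierPeriods.KontsevichZagierPeriods.Theorems.HurwitzMicroSectorsHurwitzSectorComplementStubArcRotationAux

/-!
# `HurwitzSectorComplement` (stmt-KontsevichZagierPeriods-14341, route HurwitzMicroSectors),
# line `chebyshev-level-deformation`: stub `stub_arcRotation` (S4) — grid arcs by Möbius rotations

In the half-angle chart `v = tan φ` every angle integral is an ARC representation `[I, g]`,
`g(v) = 2/(1+v²)`, over an interval `I ⊆ ℝ¹`.  For `0 < 2a < N` put `θ = π/(2N)`,
`t_k = tan(kθ)` (`0 ≤ k ≤ N − 1`; real algebraic), so that `t_{2a} = tan(πa/N)`, and let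
`I_k = (t_k, t_{k+1})` (`k ≤ N − 2`), `I_{N−1} = (t_{N−1}, ∞)` be the grid arcs.  The Möbius ROTATION
`R_k(v) = (v − t_k)/(1 + t_k v)` is a `ℚ`-semialgebraic bijection `I_k → I_0 = (0, t_1)` preserving
`dv/(1+v²)` (rule (2), `ArcRotation.rot_cov`; the endpoint identity `R_k(t_{k+1}) = t_1` is the tangent
subtraction formula `ArcRotation.grid_add`), and `v ↦ 1/v` folds `(t_{N−1}, ∞)` onto `(0, 1/t_{N−1}) = (0, t_1)`
(`ArcRotation.inv_cov`, `ArcRotation.grid_cot`) and `(1, ∞)` onto `(0,1)`.  Cutting at the null points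
`t_k` (rule (1a), `ArcRotation.line_split`) and inducting along the grid (`ladder_below`, `ladder_above`,
stated for an abstract grid `t : ℕ → ℝ` satisfying the tangent relations):
`[(0, t_{2a}), g] ≡ 2a • [I_0, g]`, `[(t_{2a}, ∞), g] ≡ (N − 2a) • [I_0, g]`,
`N • [I_0, g] ≡ [(0, ∞), g] ≡ 2 • [(0,1), g]`; the final bookkeeping is done in the quotient
`FormalRep ⧸ relations`.

References: M. Kontsevich, D. Zagier, *Periods* (2001), §1.2 rules (1), (2).
-/

noncomputable section

open Set MeasureTheory MvPolynomial
open scoped BigOperators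
open Literature.NumberTheory.Transcendental
open Literature.ModelTheory.ExponentialFields (IsSemialgebraic)

namespace Summit.KontsevichZagierPeriods.Theorems.HurwitzMicroSectorsHurwitzSectorComplement

namespace ArcRotation

open Summit.KontsevichZagierPeriods.MzvKernelInKZ.Negative

/-! ### The ladder of grid arcs (abstract grid `t` with the tangent relations) -/

section Ladder

/-- Transport along an equation of formal combinations. [folklore] -/
theorem mem_of_eq {x y : KZ.FormalRep} (h : y ∈ KZ.relations) (e : x = y) : x ∈ KZ.relations :=
  e ▸ h

/-- The grid is strictly increasing: `t_k < t_{k+1}` (`k + 1 < N`). [folklore] -/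
theorem ladder_mono {t : ℕ → ℝ} {N : ℕ} (hnonneg : ∀ k, k < N → 0 ≤ t k)
    (hpos : ∀ k, 0 < k → k < N → 0 < t k)
    (hadd : ∀ k, k + 1 < N → t k * t 1 < 1 ∧ t (k + 1) * (1 - t k * t 1) = t k + t 1)
    {k : ℕ} (hk : k + 1 < N) : t k < t (k + 1) := by
  obtain ⟨-, h2⟩ := hadd k hk
  have h1 := hpos 1 one_pos (by omega)
  have h3 := mul_nonneg (mul_nonneg (hnonneg (k + 1) hk) (hnonneg k (by omega))) h1.le
  nlinarith [h2, h3, h1]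

/-- **Arcs below the cap**: `[(0, t_m), h] ≡ m • [(0, t_1), h]` for `1 ≤ m < N` — peel the grid
arcs `(t_k, t_{k+1})` one at a time (null points `t_k`) and rotate each onto `(0, t_1)`.
[cite: KontsevichZagier2001, §1.2 rules (1), (2)] -/
theorem ladder_below {t : ℕ → ℝ} {N : ℕ} (halg : ∀ k, k < N → IsAlgebraic ℚ (t k))
    (hnonneg : ∀ k, k < N → 0 ≤ t k) (hpos : ∀ k, 0 < k → k < N → 0 < t k)
    (hadd : ∀ k, k + 1 < N → t k * t 1 < 1 ∧ t (k + 1) * (1 - t k * t 1) = t k + t 1)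
    (J : KZ.IntegralRep 1) (hJd : J.domain = {x | 0 < x 0 ∧ x 0 < t 1})
    (hJi : J.integrand = fun x => hq (x 0)) :
    ∀ m, 1 ≤ m → m < N → ∀ hm : IsSemialgebraic ℚ {x : Fin 1 → ℝ | 0 < x 0 ∧ x 0 < t m},
      KZ.of (lineRep {x | 0 < x 0 ∧ x 0 < t m} hm) - m • KZ.of J ∈ KZ.relations := by
  intro m h1m
  induction m, h1m using Nat.le_induction with
  | base =>
    intro _ hm
    rw [one_nsmul]
    exact KZ.of_sub_of_mem_relations_of_eqOn hJd fun x _ => by rw [hJi]; rfl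
  | succ m h1m ih =>
    intro hm1N hm
    have hmN : m < N := by omega
    have h1N : 1 < N := by omega
    have hsa_m : IsSemialgebraic ℚ {x : Fin 1 → ℝ | 0 < x 0 ∧ x 0 < t m} :=
      sa_Ioo isAlgebraic_zero (halg m hmN)
    have ih' := ih hmN hsa_m
    obtain ⟨hts, hu⟩ := hadd m hm1N
    have hmono := ladder_mono hnonneg hpos hadd hm1N
    have hrot := KZ.changeOfVariablesRel_subset_relations
      (rot_cov (hnonneg m hmN) (hpos 1 one_pos h1N) hts hu (halg m hmN) (halg 1 h1N)
        (halg (m + 1) hm1N))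
    have hJ0 : KZ.of (lineRep {x : Fin 1 → ℝ | 0 < x 0 ∧ x 0 < t 1}
        (sa_Ioo isAlgebraic_zero (halg 1 h1N))) - KZ.of J ∈ KZ.relations :=
      KZ.of_sub_of_mem_relations_of_eqOn hJd fun x _ => by rw [hJi]; rfl
    have hsplit := line_split hm hsa_m (sa_Ioo (halg m hmN) (halg (m + 1) hm1N))
      (fun x hx => ⟨hx.1, hx.2.trans hmono⟩)
      (fun x hx => ⟨⟨(hnonneg m hmN).trans_lt hx.1, hx.2⟩, fun h => (not_lt.mpr h.2.le) hx.1⟩)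
      (t m) (fun x hx => le_antisymm (not_lt.mp fun h => hx.2 ⟨h, hx.1.1.2⟩)
        (not_lt.mp fun h => hx.1.2 ⟨hx.1.1.1, h⟩))
    rw [succ_nsmul]
    exact mem_of_eq (add_mem (add_mem (add_mem hsplit ih') hrot) hJ0) (by abel)

/-- **Arcs above the cap**: `[(t_m, ∞), h] ≡ (N − m) • [(0, t_1), h]` for `m + j + 1 = N` — peel
the grid arcs from below, rotate each onto `(0, t_1)`, and fold the last arc `(t_{N−1}, ∞)` onto
`(0, 1/t_{N−1}) = (0, t_1)` by `v ↦ 1/v`. [cite: KontsevichZagier2001, §1.2 rules (1), (2)] -/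
theorem ladder_above {t : ℕ → ℝ} {N : ℕ} (halg : ∀ k, k < N → IsAlgebraic ℚ (t k))
    (hnonneg : ∀ k, k < N → 0 ≤ t k) (hpos : ∀ k, 0 < k → k < N → 0 < t k)
    (hadd : ∀ k, k + 1 < N → t k * t 1 < 1 ∧ t (k + 1) * (1 - t k * t 1) = t k + t 1)
    (hN : 2 ≤ N) (hcot : t (N - 1) * t 1 = 1)
    (J : KZ.IntegralRep 1) (hJd : J.domain = {x | 0 < x 0 ∧ x 0 < t 1})
    (hJi : J.integrand = fun x => hq (x 0)) :
    ∀ j m, m + j + 1 = N → ∀ hm : IsSemialgebraic ℚ {x : Fin 1 → ℝ | t m < x 0},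
      KZ.of (lineRep {x | t m < x 0} hm) - (j + 1) • KZ.of J ∈ KZ.relations := by
  intro j
  induction j with
  | zero =>
    intro m hmN hm
    obtain rfl : m = N - 1 := by omega
    have hNN : N - 1 < N := by omega
    have hinv := KZ.changeOfVariablesRel_subset_relations
      (inv_cov (hpos (N - 1) (by omega) hNN) (halg (N - 1) hNN))
    have ht1 : t 1 = (t (N - 1))⁻¹ := eq_inv_of_mul_eq_one_right hcot
    have hJ0 : KZ.of (lineRep {x : Fin 1 → ℝ | 0 < x 0 ∧ x 0 < (t (N - 1))⁻¹}
        (sa_Ioo isAlgebraic_zero (halg (N - 1) hNN).inv)) - KZ.of J ∈ KZ.relations :=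
      KZ.of_sub_of_mem_relations_of_eqOn (by rw [hJd, ht1]; rfl) fun x _ => by rw [hJi]; rfl
    rw [zero_add, one_nsmul]
    exact mem_of_eq (add_mem hinv hJ0) (by abel)
  | succ j ih =>
    intro m hmN hm
    have hm1N : m + 1 < N := by omega
    have hmN' : m < N := by omega
    have h1N : 1 < N := by omega
    obtain ⟨hts, hu⟩ := hadd m hm1N
    have hmono := ladder_mono hnonneg hpos hadd hm1N
    have hsaK : IsSemialgebraic ℚ {x : Fin 1 → ℝ | t (m + 1) < x 0} := sa_Ioi (halg (m + 1) hm1N)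
    have ih' := ih (m + 1) (by omega) hsaK
    have hrot := KZ.changeOfVariablesRel_subset_relations
      (rot_cov (hnonneg m hmN') (hpos 1 one_pos h1N) hts hu (halg m hmN') (halg 1 h1N)
        (halg (m + 1) hm1N))
    have hJ0 : KZ.of (lineRep {x : Fin 1 → ℝ | 0 < x 0 ∧ x 0 < t 1}
        (sa_Ioo isAlgebraic_zero (halg 1 h1N))) - KZ.of J ∈ KZ.relations :=
      KZ.of_sub_of_mem_relations_of_eqOn hJd fun x _ => by rw [hJi]; rfl
    have hsplit := line_split hm (sa_Ioo (halg m hmN') (halg (m + 1) hm1N)) hsaK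
      (fun x hx => hx.1)
      (fun x hx => ⟨hmono.trans hx, fun h => lt_irrefl _ (h.2.trans hx)⟩)
      (t (m + 1))
      (fun x hx => le_antisymm (not_lt.mp hx.2) (not_lt.mp fun h => hx.1.2 ⟨hx.1.1, h⟩))
    rw [succ_nsmul]
    exact mem_of_eq (add_mem (add_mem (add_mem hsplit hrot) hJ0) ih') (by abel)

end Ladder

/-- Membership in `KZ.relations` read in the quotient group. [folklore] -/
theorem mk_eq_of_sub_mem {x y : KZ.FormalRep} (h : x - y ∈ KZ.relations) :
    (QuotientAddGroup.mk x : KZ.FormalRep ⧸ KZ.relations) = QuotientAddGroup.mk y :=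
  QuotientAddGroup.eq_iff_sub_mem.mpr h

/-- Membership in `KZ.relations` read in the quotient group (scalar form). [folklore] -/
theorem mk_eq_nsmul_of_sub_mem {x y : KZ.FormalRep} {n : ℕ} (h : x - n • y ∈ KZ.relations) :
    (QuotientAddGroup.mk x : KZ.FormalRep ⧸ KZ.relations) = n • QuotientAddGroup.mk y := by
  rw [← QuotientAddGroup.mk_nsmul]
  exact QuotientAddGroup.eq_iff_sub_mem.mpr h

end ArcRotation

open ArcRotation Summit.KontsevichZagierPeriods.MzvKernelInKZ.Negative in
/-- **S4 (grid arcs by Möbius rotations).** For `0 < 2a < N`, `V = tan(πa/N)` and `t₁ = tan(π/2N)` are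
positive real algebraic numbers, and with `α = [(0,t₁), g]`: `[(0,V), g] ≡ 2a • α`, `[(V,∞), g] ≡ (N−2a) • α`,
`N • α ≡ 2 • [(0,1), g]` — the rotations `v ↦ (v − t_k)/(1 + t_k v)`, `t_k = tan(kπ/2N)`, are `ℚ`-semialgebraic
bijections between consecutive grid arcs preserving `dv/(1+v²)`, and `v ↦ 1/v` folds `(1,∞)` onto `(0,1)`.
[cite: KontsevichZagier2001, §1.2 rules (1), (2)] -/
theorem stub_arcRotation : ∀ (g : ℝ → ℝ), (∀ v, g v = 2 / (1 + v ^ 2)) → ∀ (N a : ℕ), 0 < a → 2 * a < N → IsAlgebraic ℚ (Real.tan (Real.pi * a / N)) ∧ 0 < Real.tan (Real.pi * a / N) ∧ IsAlgebraic ℚ (Real.tan (Real.pi / (2 * N))) ∧ 0 < Real.tan (Real.pi / (2 * N)) ∧ ∀ (A L α Q : KZ.IntegralRep 1), A.domain = {y | 0 < y 0 ∧ y 0 < Real.tan (Real.pi * a / N)} → Set.EqOn A.integrand (fun y => g (y 0)) A.domain → L.domain = {y | Real.tan (Real.pi * a / N) < y 0} → Set.EqOn L.integrand (fun y => g (y 0))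 L.domain → α.domain = {y | 0 < y 0 ∧ y 0 < Real.tan (Real.pi / (2 * N))} → Set.EqOn α.integrand (fun y => g (y 0)) α.domain → Q.domain = {y | 0 < y 0 ∧ y 0 < 1} → Set.EqOn Q.integrand (fun y => g (y 0)) Q.domain → KZ.of A - (2 * a) • KZ.of α ∈ KZ.relations ∧ KZ.of L - (N - 2 * a) • KZ.of α ∈ KZ.relations ∧ N • KZ.of α - 2 • KZ.of Q ∈ KZ.relations := by
  intro g hg N a ha haN
  have hN1 : 1 < N := by omega
  -- the two angles as grid angles `k · π/(2N)`
  have e2a : Real.pi * a / N = ((2 * a : ℕ) : ℝ) * (Real.pi / (2 * N)) := by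
    push_cast; ring
  have e1 : Real.pi / (2 * N) = ((1 : ℕ) : ℝ) * (Real.pi / (2 * N)) := by simp
  refine ⟨?_, ?_, ?_, ?_, ?_⟩
  · rw [e2a]; exact grid_isAlgebraic N (2 * a)
  · rw [e2a]; exact grid_pos (by omega) haN
  · rw [e1]; exact grid_isAlgebraic N 1
  · rw [e1]; exact grid_pos one_pos hN1
  intro A L α Q hAd hAi hLd hLi hαd hαi hQd hQi
  -- the grid `t k = tan(kπ/2N)` as an abstract sequence with the tangent relations
  obtain ⟨t, ht⟩ : ∃ t : ℕ → ℝ, t = fun k : ℕ => Real.tan ((k : ℝ) * (Real.pi / (2 * N))) :=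
    ⟨_, rfl⟩
  have halg : ∀ k, k < N → IsAlgebraic ℚ (t k) := fun k _ => by rw [ht]; exact grid_isAlgebraic N k
  have hnonneg : ∀ k, k < N → 0 ≤ t k := fun k hk => by rw [ht]; exact grid_nonneg hk
  have hpos : ∀ k, 0 < k → k < N → 0 < t k := fun k h0 hk => by rw [ht]; exact grid_pos h0 hk
  have hadd : ∀ k, k + 1 < N → t k * t 1 < 1 ∧ t (k + 1) * (1 - t k * t 1) = t k + t 1 :=
    fun k hk => by rw [ht]; exact grid_add hk
  have hcot : t (N - 1) * t 1 = 1 := by rw [ht]; exact grid_cot (by omega)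
  have ht0 : t 0 = 0 := by rw [ht]; simp
  have ht1 : Real.tan (Real.pi / (2 * N)) = t 1 := by rw [ht]; simp
  have ht2a : Real.tan (Real.pi * a / N) = t (2 * a) := by rw [ht, e2a]
  -- `J = [(0, t_1), h]` on the domain of `α`
  have hJd : (lineRep α.domain α.isSemialgebraic_domain).domain = {x | 0 < x 0 ∧ x 0 < t 1} := by
    rw [← ht1]; exact hαd
  have hJi : (lineRep α.domain α.isSemialgebraic_domain).integrand = fun x => hq (x 0) := rfl
  -- `[r, g] ≡ 2 • [r.domain, h]` for the four given representations
  have qA := mk_eq_nsmul_of_sub_mem (of_sub_two_lineRep g hg A hAi)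
  have qL := mk_eq_nsmul_of_sub_mem (of_sub_two_lineRep g hg L hLi)
  have qα := mk_eq_nsmul_of_sub_mem (of_sub_two_lineRep g hg α hαi)
  have qQ := mk_eq_nsmul_of_sub_mem (of_sub_two_lineRep g hg Q hQi)
  -- (i) below the cap
  have hsaA : IsSemialgebraic ℚ {x : Fin 1 → ℝ | 0 < x 0 ∧ x 0 < t (2 * a)} :=
    sa_Ioo isAlgebraic_zero (halg _ haN)
  have qA' := mk_eq_of_sub_mem (lineRep_congr A.isSemialgebraic_domain hsaA (by rw [hAd, ht2a]))
  have qbelow := mk_eq_nsmul_of_sub_mem (ladder_below halg hnonneg hpos hadd _ hJd hJi (2 * a)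
    (by omega) haN hsaA)
  -- (ii) above the cap
  have hsaK : IsSemialgebraic ℚ {x : Fin 1 → ℝ | t (2 * a) < x 0} := sa_Ioi (halg _ haN)
  have qL' := mk_eq_of_sub_mem (lineRep_congr L.isSemialgebraic_domain hsaK (by rw [hLd, ht2a]))
  have habove := ladder_above halg hnonneg hpos hadd (by omega) hcot _ hJd hJi (N - 2 * a - 1) (2 * a)
    (by omega) hsaK
  rw [Nat.sub_add_cancel (by omega : 1 ≤ N - 2 * a)] at habove
  have qabove := mk_eq_nsmul_of_sub_mem habove
  -- (iii) the whole half-line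
  have hsaH : IsSemialgebraic ℚ {x : Fin 1 → ℝ | t 0 < x 0} := sa_Ioi (halg 0 (by omega))
  have hhalf := ladder_above halg hnonneg hpos hadd (by omega) hcot _ hJd hJi (N - 1) 0 (by omega) hsaH
  rw [Nat.sub_add_cancel (by omega : 1 ≤ N)] at hhalf
  have qhalf := mk_eq_nsmul_of_sub_mem hhalf
  have qH := mk_eq_of_sub_mem (lineRep_congr hsaH (sa_Ioi isAlgebraic_zero)
    (show {x : Fin 1 → ℝ | t 0 < x 0} = {x | 0 < x 0} by rw [ht0]))
  have qtwo := mk_eq_nsmul_of_sub_mem halfline_two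
  have qQ' := mk_eq_of_sub_mem (lineRep_congr Q.isSemialgebraic_domain sa_L01 (by rw [hQd]; rfl))
  refine ⟨QuotientAddGroup.eq_iff_sub_mem.mp ?_, QuotientAddGroup.eq_iff_sub_mem.mp ?_,
    QuotientAddGroup.eq_iff_sub_mem.mp ?_⟩
  · rw [QuotientAddGroup.mk_nsmul, qA, qA', qbelow, qα, smul_comm]
  · rw [QuotientAddGroup.mk_nsmul, qL, qL', qabove, qα, smul_comm]
  · rw [QuotientAddGroup.mk_nsmul, QuotientAddGroup.mk_nsmul, qα, qQ, qQ', ← qtwo, ← qH, qhalf, smul_comm]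

end Summit.KontsevichZagierPeriods.Theorems.HurwitzMicroSectorsHurwitzSectorComplement

end
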